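import Summits.QuantumFields.YangMills.Theorems.BalabanUVNodesN15TwoGridAveragingDefect
import Summits.QuantumFields.YangMills.Theorems.BalabanUVNodesN15TwoGridLandauDefectFull
import Literature.MathematicalPhysics.QuantumFieldTheory.Balaban1983to89.B9Eq3130MatrixLetters
import HarnessLib

/-!
# THE GLUING STEP AT TWO LATTICE SPACINGS, LVII: THE TWO-GRID OPERATOR LETTER OF BAŁABAN's AVERAGING `Q*Q` ON ROUGH INPUTS — `𝔇(Q′*Q′, Q*Q) ≤ (4e^{2ρ}∕L^k)·e^{−ρd}` —
# AND OF THE NONLOCAL PART `N_L = a•Q*Q − ∂Π∂*` OF `Δ_a` (dag-n15-c g14, FILE 99; N15 = NE2, s1 «background-layer OPERATOR ingredient»)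

Cell `pub-ymgap`, seat `pub-ymgap-dag-n15-c` (R134 (a); HUMAN RULING D-0062), generation 14.  `bears_on: R4∕N15 · K3⁸ SpineGivenEndpointR13SepCoPHV (stmt-QuantumFields-27366)`.
Filed `--supports stmt-QuantumFields-27366 --as helper` — COUNT-NEUTRAL.  Theorems only (0 `def`, 0 `sorry`).  Imports BY NAME dag-n15-a part 45 `…N15TwoGridAveragingDefect` (`abs_qsOp_apply_le`,
`hasMaj_qvRe_comp`, `hasMaj_qvAdjRe_comp`, `hasMaj_qvAdjRe_sub_pull_comp`; through it part 37 `qvRe_pull_sub_apply`, part 44 `sA_sub_one` ∕ `hasMaj_shiftPull_sub`, part 40 `hasMaj_sT_pow_comp` ∕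
`hasMaj_finsum` ∕ `hasMaj_smul_ofBlocks`, lit `B9Eq3130MatrixLetters.hasMaj_id_ofBlocks`) and part 47ff `…N15TwoGridLandauDefectFull` (`hasMaj_landauDefect_family`); nothing in the tree is modified.

WHY.  The last displayed row of this seat's knit (FILE 96 `ne2PlusOperator_knit_of_rightDefect` → FILE 97∕98: `𝔇(R̃′, R̃)`, the adjoint remainder's two-grid defect) reduces per cube to the
SOURCE-side defect `𝔇((M_{χ′}G′(□))∘[N′_L, M_{h′}], (M_χG(□))∘[N_L, M_h])` of the nonlocal part `N_L = a•Q*Q − ∂Π∂*` of Bałaban's `Δ_a` behind the cut cube; my g11 FILE 56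
`hasMaj_idef_commOp_nonlocal` turns that into the OPERATOR letter `𝔇(N′_L, N_L)` on ROUGH inputs (WANT-n15-a g13-2 (β), unanswered).  The Landau half `𝔇(∂Π∂*′, ∂Π∂*)` is dag-n15-a's part 47ff
`hasMaj_landauDefect_family`; the averaging half was held not to exist on rough inputs (N-IIm: part 45's route bounds `Q′P − Q` through the one-step difference `(s_κ − 1)u` of the
INPUT).  It does exist: in part 37's exact identity `Q′P − Q = Q′^s∘(A′_κ(L^m) − 1)∘P∘A_κ(L^k)` the coarse line filter `A_κ(L^k) = (L^k)⁻¹Σ_{t<L^k}s_κ^t` TELESCOPES the one-step difference,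
`(s_κ − 1)·a_κ(L^k) = (L^k)⁻¹(s_κ^{L^k} − 1)` (`mul_geom_sum`) — a unit translation minus the identity, times `η = L^{−k}` — so `‖Q′P − Q‖ ≤ 2e^{ρ}∕L^k` blockwise with NO derivative on the
input, and with part 45's stencil comparison `Q′* − PQ* = O(L^{−k})`: `𝔇(Q′*Q′, Q*Q) = Q′*(Q′P − Q) + (Q′* − PQ*)Q ≤ (4e^{2ρ}∕L^k)·e^{−ρd}`.

WHAT.  §1 `smul_sD_mul_sA_eq` (the symbol telescoping), ★ `hasMaj_lineDiff_comp` (`(n⁻¹ρ(n(s_κ−1)))∘ρ(a_κ(n))∘S = n⁻¹(ρ(s_κ^n) − 1)∘S ≤ (2e^{ρ}∕n)·B·e^{−ρd}`), ★ `hasMaj_qvRe_pull_sub_comp_of_line`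
(dag-n15-a part 45 `hasMaj_qvRe_pull_sub_comp` with the COMPOSED line-difference letter as its hypothesis — the same proof), ★★ **`hasMaj_idef_qq`**: on ANY torus `M`, any `k, m`, `ρ ≥ 0`,
  `HasMaj (ofBlocks … blkFine) (ofBlocks … blockOf_{L^mL^k}) (𝔇(Q′*Q′, Q*Q)) ((4e^{ρ}e^{ρ}∕L^k)·e^{−ρ|y−y′|_T})`  (`𝔇 = idef (pull kingPrV) (pull kingPrV)`, King's pairing).
§2 ★★ `hasMaj_idef_nonlocal_of` (`𝔇(a•Q′*Q′ − V′, a•Q*Q − V) ≤ (|a|·4e^{2ρ}∕L^k + r_V)·e^{−ρd}` given the Landau letter `𝔇(V′, V) ≤ r_Ve^{−ρd}`), ★★ **`hasMaj_idef_nonlocal_family`**: for odd `L ≥ 3`,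
`a > 0`, `0 < γ < 1` there are `δ, r > 0` with, for every `m_T`, `k ≥ 1`, `m`, on `MP (paramsOf d L m_T k hL)`:
  `𝔇(a•Q′*Q′ − ∂Π∂*′, a•Q*Q − ∂Π∂*) ≤ r·(L^k)^{−γ∕2}·e^{−δ|y−y′|_T}`  (Landau half = part 47ff BY NAME, `L^{−k} ≤ (L^k)^{−γ∕2}`).
CONSUMER: the next file (`…NeumannKnitRightNonlocal`) feeds §2 to FILE 56 `hasMaj_idef_commOp_nonlocal` and discharges the `hDN` row of FILE 98; then `𝔇(R̃′, R̃)` and FILE 50's socket for the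
cover's glued `U ≡ 1` pair are hypothesis-free.

HONEST FRAMING ∕ LIMITS.  Finite-dimensional lattice algebra + block-majorant bookkeeping over LANDED rows; constants crude and ours; `U ≡ 1` torus MODEL of [B5] §1; Bałaban's inequalities
enter only through the tree's theorems behind part 47ff; nothing of [B5]∕[B6]∕[B9] asserted ([B9] Thm 3.14 = difference TEMPLATE).  NE2⁺ NOT PRINTED, NOT proved; N15 NOT discharged; counts
of record UNMOVED (typed 28∕28 · discharged 5∕27); one finite 𝕋⁴ at fixed ε per index — NOT infinite volume, NOT OS on ℝ⁴, NOT a mass gap, NOT Clay; R4 closes `BalabanLadder.UV` only.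
Restate-immune (no Theses import).
-/

noncomputable section

open scoped BigOperators
open Finset

namespace Summit.QuantumFields.YangMills.BalabanUVNodes.N15.Gluing

open Literature.MathematicalPhysics.QuantumFieldTheory.Balaban1983to89
open Literature.MathematicalPhysics.QuantumFieldTheory.Balaban1983to89.B11SectG (BlockNorm HasMaj)
open Literature.MathematicalPhysics.QuantumFieldTheory.Balaban1983to89.B11AxialTransport190 (abs_le_loc_ofBlocks loc_ofBlocks_le)
open Literature.MathematicalPhysics.QuantumFieldTheory.Balaban1983to89.B9Eq3130MatrixLetters (hasMaj_id_ofBlocks)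
open Literature.MathematicalPhysics.QuantumFieldTheory.Balaban1983to89.B5Prop11Plancherel (Tor fine unitVec)
open Literature.MathematicalPhysics.QuantumFieldTheory.Balaban1983to89.T4EtaRateDefect (idef)
open Literature.MathematicalPhysics.QuantumFieldTheory.Balaban1983to89.T4EtaRateCoeffDefect (pull pull_apply)
open Literature.MathematicalPhysics.QuantumFieldTheory.Balaban1983to89.B6UnitTorusCarrier (unitTorusGeo unitTorusGeo_dist_self)
open Literature.MathematicalPhysics.QuantumFieldTheory.Balaban1983to89.B5SiteBridgeP12 (MP)
open Literature.MathematicalPhysics.QuantumFieldTheory.King1986.Torus (blockOf tdistT tdistT_nonneg)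
open Summit.QuantumFields.YangMills.BalabanUVNodes.N15.VectorPiece (kingPrV blkFine)
open Summit.QuantumFields.YangMills.BalabanUVNodes.N15.TwoGrid

variable {d : ℕ}

/-! ## §1 The line filter telescopes the one-step difference: the operator letter of `Q′P − Q` and of `𝔇(Q′*Q′, Q*Q)` on rough inputs -/

section Line

variable {L : ℕ} [NeZero L] (M : Fin (d + 1) → ℕ) [∀ μ, NeZero (M μ)] (k n : ℕ) [NeZero n] {F₁ : Type} [AddCommGroup F₁] [Module ℝ F₁]

omit [∀ μ, NeZero (M μ)] in
/-- THE SYMBOL TELESCOPING: `(n⁻¹·n(s_κ − 1))·a_κ(n) = n⁻¹·(s_κ^n − 1)` — the box filter of `n` steps turns the one-step difference into the `n`-step one (`mul_geom_sum`). [folklore] -/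
theorem smul_sD_mul_sA_eq (κ : Fin (d + 1)) : ((n : ℝ)⁻¹ • sD M n κ (n : ℝ)) * sA M n κ n = (n : ℝ)⁻¹ • (sT M n κ ^ n - 1) := by
  have hn : (n : ℝ) ≠ 0 := Nat.cast_ne_zero.mpr (NeZero.ne n)
  rw [sD, smul_smul, inv_mul_cancel₀ hn, one_smul, sA, mul_smul_comm, mul_geom_sum]

omit [NeZero L] in
/-- ★ **THE LINE-DIFFERENCE LETTER**: `(n⁻¹ρ(n(s_κ − 1)))∘ρ(a_κ(n))∘S = n⁻¹·(ρ(s_κ^n)∘S − S)` — a translation by ONE UNIT BLOCK minus the identity, times `n⁻¹` — so if `S ≤ B·e^{−ρd}` into fine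
1-forms blocked by King's unit blocks then it is `≤ (2e^{ρ}∕n)·B·e^{−ρd}` (`hasMaj_sT_pow_comp` at `j = n`). [folklore] -/
theorem hasMaj_lineDiff_comp {b₁ : BlockNorm (unitTorusGeo L k M) F₁} {S : F₁ →ₗ[ℝ] (Tor (fine n M) × Fin (d + 1) → ℝ)} {B ρ : ℝ} (hB : 0 ≤ B) (hρ : 0 ≤ ρ) (κ : Fin (d + 1))
    (h : HasMaj b₁ (BlockNorm.ofBlocks (unitTorusGeo L k M) (fun i : Tor (fine n M) × Fin (d + 1) => blockOf n M i.1)) S (fun y y' => B * Real.exp (-(ρ * tdistT M y y')))) :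
    HasMaj b₁ (BlockNorm.ofBlocks (unitTorusGeo L k M) (fun i : Tor (fine n M) × Fin (d + 1) => blockOf n M i.1))
      (((n : ℝ)⁻¹ • symbOp M n (sD M n κ (n : ℝ))) ∘ₗ (symbOp M n (sA M n κ n) ∘ₗ S))
      (fun y y' => 2 * Real.exp ρ / (n : ℝ) * B * Real.exp (-(ρ * tdistT M y y'))) := by
  have hn0 : (0 : ℝ) < (n : ℝ) := by exact_mod_cast Nat.pos_of_ne_zero (NeZero.ne n)
  have hsym : ((n : ℝ)⁻¹ • symbOp M n (sD M n κ (n : ℝ))) * symbOp M n (sA M n κ n) = (n : ℝ)⁻¹ • (symbOp M n (sT M n κ ^ n) - 1) := by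
    rw [← map_smul, ← map_mul, smul_sD_mul_sA_eq, map_smul, map_sub, map_pow, map_one]
  have hop : (((n : ℝ)⁻¹ • symbOp M n (sD M n κ (n : ℝ))) ∘ₗ (symbOp M n (sA M n κ n) ∘ₗ S)) = (n : ℝ)⁻¹ • (symbOp M n (sT M n κ ^ n) ∘ₗ S - S) := by
    rw [← LinearMap.comp_assoc, ← Module.End.mul_eq_comp, hsym, LinearMap.smul_comp, LinearMap.sub_comp, Module.End.one_eq_id, LinearMap.id_comp]
  have he : 1 ≤ Real.exp ρ := Real.one_le_exp hρ
  have h1 := hasMaj_sT_pow_comp M k n hB hρ κ (le_refl n) h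
  have h2 : HasMaj b₁ (BlockNorm.ofBlocks (unitTorusGeo L k M) (fun i : Tor (fine n M) × Fin (d + 1) => blockOf n M i.1)) S
      (fun y y' => B * Real.exp ρ * Real.exp (-(ρ * tdistT M y y'))) :=
    h.mono fun y y' => mul_le_mul_of_nonneg_right (le_mul_of_one_le_right hB he) (Real.exp_nonneg _)
  have h3 := hasMaj_smul_ofBlocks (g := unitTorusGeo L k M) (b₁ := b₁) (fun i : Tor (fine n M) × Fin (d + 1) => blockOf n M i.1)
    (fun y y' => by positivity) ((n : ℝ)⁻¹) (h1.sub h2)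
  rw [hop]
  refine h3.mono fun y y' => le_of_eq ?_
  rw [abs_of_nonneg (inv_nonneg.mpr hn0.le)]
  field_simp
  ring

variable (m : ℕ)

/-- ★ **THE TWO-GRID CONSISTENCY OF `Q` FROM THE COMPOSED LINE-DIFFERENCE LETTER** — dag-n15-a part 45 `hasMaj_qvRe_pull_sub_comp` with its internal letter `hAS` as the hypothesis (same proof,
verbatim from there on): if for every `κ` the composed operator `(n⁻¹ρ(n(s_κ−1)))∘ρ(a_κ(n))∘S` (`n = L^k`) has majorant `B·e^{−ρd}`, then `(Q′∘P − Q)∘S ≤ B·e^{−ρd}` into unit-lattice 1-forms —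
part 37 `qvRe_pull_sub_apply`, part 44 `sA_sub_one` ∕ `hasMaj_shiftPull_sub`. [cite: Balaban1984PropagatorsI, (1.18) p.20; King1986, p.664 (the pairing)] -/
theorem hasMaj_qvRe_pull_sub_comp_of_line {b₁ : BlockNorm (unitTorusGeo L k M) F₁} {S : F₁ →ₗ[ℝ] (Tor (fine (L ^ k) M) × Fin (d + 1) → ℝ)} {B ρ : ℝ} (hB : 0 ≤ B)
    (hAS : ∀ κ : Fin (d + 1), HasMaj b₁ (BlockNorm.ofBlocks (unitTorusGeo L k M) (blkFine L k M))
      ((((L ^ k : ℕ) : ℝ)⁻¹ • symbOp M (L ^ k) (sD M (L ^ k) κ ((L ^ k : ℕ) : ℝ))) ∘ₗ (symbOp M (L ^ k) (sA M (L ^ k) κ (L ^ k)) ∘ₗ S))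
      (fun y y' => B * Real.exp (-(ρ * tdistT M y y')))) :
    HasMaj b₁ (BlockNorm.ofBlocks (unitTorusGeo L k M) (fun b : Tor M × Fin (d + 1) => b.1))
      ((qvRe M (L ^ m * L ^ k) ∘ₗ pull (kingPrV L k m M) - qvRe M (L ^ k)) ∘ₗ S)
      (fun y y' => B * Real.exp (-(ρ * tdistT M y y'))) := by
  classical
  have hL0 : 0 < L := Nat.pos_of_ne_zero (NeZero.ne L)
  have hR0 : L ^ m ≠ 0 := by positivity
  have hR' : (0 : ℝ) < ((L ^ m : ℕ) : ℝ) := by exact_mod_cast Nat.pos_of_ne_zero hR0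
  have hK0 : ∀ y y' : Tor M, 0 ≤ B * Real.exp (-(ρ * tdistT M y y')) := fun y y' => mul_nonneg hB (Real.exp_nonneg _)
  -- per direction `κ`: the operator `E_κ := ρ′(a′_κ(L^m) − 1)∘P∘ρ(a_κ(L^k))∘S` and its majorant
  have hE : ∀ κ : Fin (d + 1), HasMaj b₁ (BlockNorm.ofBlocks (unitTorusGeo L k M) (fun i : Tor (fine (L ^ m * L ^ k) M) × Fin (d + 1) => blockOf (L ^ m * L ^ k) M i.1))
      (symbOp M (L ^ m * L ^ k) (sA M (L ^ m * L ^ k) κ (L ^ m) - 1) ∘ₗ (pull (kingPrV L k m M) ∘ₗ (symbOp M (L ^ k) (sA M (L ^ k) κ (L ^ k)) ∘ₗ S)))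
      (fun y y' => B * Real.exp (-(ρ * tdistT M y y'))) := by
    intro κ
    have hJ : ∀ j ∈ range (L ^ m), HasMaj b₁ (BlockNorm.ofBlocks (unitTorusGeo L k M) (fun i : Tor (fine (L ^ m * L ^ k) M) × Fin (d + 1) => blockOf (L ^ m * L ^ k) M i.1))
        ((symbOp M (L ^ m * L ^ k) (sT M (L ^ m * L ^ k) κ ^ j) ∘ₗ pull (kingPrV L k m M) - pull (kingPrV L k m M)) ∘ₗ (symbOp M (L ^ k) (sA M (L ^ k) κ (L ^ k)) ∘ₗ S))
        (fun y y' => B * Real.exp (-(ρ * tdistT M y y'))) :=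
      fun j hj => hasMaj_shiftPull_sub M k m hK0 κ (mem_range.mp hj).le (hAS κ)
    have hsumJ := hasMaj_finsum (g := unitTorusGeo L k M) (b₁ := b₁)
      (b₂ := BlockNorm.ofBlocks (unitTorusGeo L k M) (fun i : Tor (fine (L ^ m * L ^ k) M) × Fin (d + 1) => blockOf (L ^ m * L ^ k) M i.1)) (range (L ^ m))
      (fun j => (symbOp M (L ^ m * L ^ k) (sT M (L ^ m * L ^ k) κ ^ j) ∘ₗ pull (kingPrV L k m M) - pull (kingPrV L k m M)) ∘ₗ (symbOp M (L ^ k) (sA M (L ^ k) κ (L ^ k)) ∘ₗ S))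
      (fun _ y y' => B * Real.exp (-(ρ * tdistT M y y'))) hJ
    refine ((hasMaj_smul_ofBlocks (g := unitTorusGeo L k M) (fun i : Tor (fine (L ^ m * L ^ k) M) × Fin (d + 1) => blockOf (L ^ m * L ^ k) M i.1)
      (fun y y' => sum_nonneg fun _ _ => hK0 y y') (((L ^ m : ℕ) : ℝ)⁻¹) hsumJ).congr fun μ => ?_).mono fun y y' => le_of_eq ?_
    · rw [sA_sub_one M (L ^ m * L ^ k) κ hR0]
      simp only [LinearMap.smul_apply, LinearMap.sum_apply, LinearMap.comp_apply, LinearMap.sub_apply, map_smul, map_sum, map_sub, map_one,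
        Module.End.one_apply]
    · rw [sum_const, card_range, nsmul_eq_mul, abs_of_nonneg (inv_nonneg.mpr hR'.le), ← mul_assoc, inv_mul_cancel₀ hR'.ne', one_mul]
  intro y' μ hμ y
  refine loc_ofBlocks_le (g := unitTorusGeo L k M) (fun b : Tor M × Fin (d + 1) => b.1) _ (mul_nonneg (hK0 y y') (b₁.loc_nonneg y' μ)) fun b hb => ?_
  rw [LinearMap.comp_apply, LinearMap.sub_apply, LinearMap.comp_apply, Pi.sub_apply, qvRe_pull_sub_apply]
  calc |qsOp M (L ^ m * L ^ k) (symbOp M (L ^ m * L ^ k) (sA M (L ^ m * L ^ k) b.2 (L ^ m) - 1)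
          (pull (kingPrV L k m M) (symbOp M (L ^ k) (sA M (L ^ k) b.2 (L ^ k)) (S μ)))) b|
      ≤ (BlockNorm.ofBlocks (unitTorusGeo L k M) (fun i : Tor (fine (L ^ m * L ^ k) M) × Fin (d + 1) => blockOf (L ^ m * L ^ k) M i.1)).loc b.1
          ((symbOp M (L ^ m * L ^ k) (sA M (L ^ m * L ^ k) b.2 (L ^ m) - 1) ∘ₗ (pull (kingPrV L k m M) ∘ₗ (symbOp M (L ^ k) (sA M (L ^ k) b.2 (L ^ k)) ∘ₗ S))) μ) :=
        abs_qsOp_apply_le M k (L ^ m * L ^ k) _ b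
    _ ≤ B * Real.exp (-(ρ * tdistT M y y')) * b₁.loc y' μ := by rw [hb]; exact hE b.2 y' μ hμ y

/-- ★★ **THE TWO-GRID OPERATOR LETTER OF BAŁABAN's `Q*Q` ON ROUGH INPUTS**: on ANY torus `M`, for every coarse scale exponent `k`, refinement `m` and `ρ ≥ 0`,
  `𝔇(Q′*Q′, Q*Q) = Q′*Q′P − PQ*Q ≤ (4e^{ρ}e^{ρ}∕L^k)·e^{−ρ|y−y′|_T}`
(`Q′*(Q′P − Q) + (Q′* − PQ*)Q`: the line-difference letter of the IDENTITY is `2e^{ρ}∕L^k`, `Q′*` costs `e^{ρ}`; `Q` costs `e^{ρ}`, the stencil comparison `2e^{ρ}∕L^k`).  No derivative, no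
smoothing of the input — the letter dag-n15-a N-IIm held not to exist. [cite: Balaban1984PropagatorsI, (1.18) p.20 (stencils of Q, Q*); King1986, Prop. 3.9 (3.73) p.665 (η-rate shape)] -/
theorem hasMaj_idef_qq {ρ : ℝ} (hρ : 0 ≤ ρ) :
    HasMaj (BlockNorm.ofBlocks (unitTorusGeo L k M) (blkFine L k M))
      (BlockNorm.ofBlocks (unitTorusGeo L k M) (fun i : Tor (fine (L ^ m * L ^ k) M) × Fin (d + 1) => blockOf (L ^ m * L ^ k) M i.1))
      (idef (pull (kingPrV L k m M)) (pull (kingPrV L k m M)) (qvAdjRe M (L ^ m * L ^ k) ∘ₗ qvRe M (L ^ m * L ^ k)) (qvAdjRe M (L ^ k) ∘ₗ qvRe M (L ^ k)))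
      (fun y y' => 4 * Real.exp ρ * Real.exp ρ / (L : ℝ) ^ k * Real.exp (-(ρ * tdistT M y y'))) := by
  have hL0 : 0 < L := Nat.pos_of_ne_zero (NeZero.ne L)
  have hLk : (0 : ℝ) < ((L ^ k : ℕ) : ℝ) := by positivity
  have hsplit : idef (pull (kingPrV L k m M)) (pull (kingPrV L k m M)) (qvAdjRe M (L ^ m * L ^ k) ∘ₗ qvRe M (L ^ m * L ^ k)) (qvAdjRe M (L ^ k) ∘ₗ qvRe M (L ^ k)) =
      qvAdjRe M (L ^ m * L ^ k) ∘ₗ ((qvRe M (L ^ m * L ^ k) ∘ₗ pull (kingPrV L k m M) - qvRe M (L ^ k)) ∘ₗ LinearMap.id) +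
        (qvAdjRe M (L ^ m * L ^ k) - pull (kingPrV L k m M) ∘ₗ qvAdjRe M (L ^ k)) ∘ₗ (qvRe M (L ^ k) ∘ₗ LinearMap.id) := by
    simp only [idef, LinearMap.comp_id, LinearMap.comp_sub, LinearMap.sub_comp, LinearMap.comp_assoc]
    abel
  have h0 := hasMaj_id_ofBlocks (g := unitTorusGeo L k M) (blkFine L k M) (unitTorusGeo_dist_self (L := L) (k := k) (M := M)) ρ
  -- piece 1: `Q′*∘(Q′P − Q)`
  have hline : ∀ κ : Fin (d + 1), HasMaj (BlockNorm.ofBlocks (unitTorusGeo L k M) (blkFine L k M)) (BlockNorm.ofBlocks (unitTorusGeo L k M) (blkFine L k M))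
      ((((L ^ k : ℕ) : ℝ)⁻¹ • symbOp M (L ^ k) (sD M (L ^ k) κ ((L ^ k : ℕ) : ℝ))) ∘ₗ (symbOp M (L ^ k) (sA M (L ^ k) κ (L ^ k)) ∘ₗ LinearMap.id))
      (fun y y' => 2 * Real.exp ρ / ((L ^ k : ℕ) : ℝ) * 1 * Real.exp (-(ρ * tdistT M y y'))) := fun κ =>
    hasMaj_lineDiff_comp M k (L ^ k) zero_le_one hρ κ h0
  have hA := hasMaj_qvRe_pull_sub_comp_of_line M k m (B := 2 * Real.exp ρ / ((L ^ k : ℕ) : ℝ) * 1) (by positivity) hline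
  have hA' := hasMaj_qvAdjRe_comp M k (L ^ m * L ^ k) (B := 2 * Real.exp ρ / ((L ^ k : ℕ) : ℝ) * 1) (by positivity) hρ hA
  -- piece 2: `(Q′* − PQ*)∘Q`
  have hQ := hasMaj_qvRe_comp M k (L ^ k) zero_le_one hρ h0
  have hB2 := hasMaj_qvAdjRe_sub_pull_comp M k m (B := 1 * Real.exp ρ) (by positivity) hρ hQ
  rw [hsplit]
  refine (hA'.add hB2).mono fun y y' => le_of_eq ?_
  rw [Nat.cast_pow]
  ring

end Line

/-! ## §2 The operator letter of the nonlocal part `N_L = a•Q*Q − ∂Π∂*` -/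

section Nonlocal

variable {L : ℕ} [NeZero L] (M : Fin (d + 1) → ℕ) [∀ μ, NeZero (M μ)] (k m : ℕ)

/-- ★★ **THE OPERATOR LETTER OF THE NONLOCAL PART, per torus**: given the Landau letter `𝔇(V′, V) = V′P − PV ≤ r_V·e^{−ρd}` (`V = landauRe = ∂Π∂*`),
  `𝔇(a•Q′*Q′ − V′, a•Q*Q − V) ≤ (|a|·4e^{ρ}e^{ρ}∕L^k + r_V)·e^{−ρd}`  (§1 + linearity of `𝔇` in the operator pair).
[cite: Balaban1984PropagatorsI, (1.69)–(1.70) pp.29–30 (Δ_a = Δ + aQ*Q − ∂P∂*: shape); King1986, Prop. 3.9 (3.73) p.665 (η-rate shape)] -/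
theorem hasMaj_idef_nonlocal_of {a rV ρ : ℝ} (hρ : 0 ≤ ρ)
    (hDV : HasMaj (BlockNorm.ofBlocks (unitTorusGeo L k M) (blkFine L k M))
      (BlockNorm.ofBlocks (unitTorusGeo L k M) (fun i : Tor (fine (L ^ m * L ^ k) M) × Fin (d + 1) => blockOf (L ^ m * L ^ k) M i.1))
      (landauRe M (L ^ m * L ^ k) ∘ₗ pull (kingPrV L k m M) - pull (kingPrV L k m M) ∘ₗ landauRe M (L ^ k)) (fun y y' => rV * Real.exp (-(ρ * tdistT M y y')))) :
    HasMaj (BlockNorm.ofBlocks (unitTorusGeo L k M) (blkFine L k M))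
      (BlockNorm.ofBlocks (unitTorusGeo L k M) (fun i : Tor (fine (L ^ m * L ^ k) M) × Fin (d + 1) => blockOf (L ^ m * L ^ k) M i.1))
      (idef (pull (kingPrV L k m M)) (pull (kingPrV L k m M))
        (a • (qvAdjRe M (L ^ m * L ^ k) ∘ₗ qvRe M (L ^ m * L ^ k)) + (-landauRe M (L ^ m * L ^ k))) (a • (qvAdjRe M (L ^ k) ∘ₗ qvRe M (L ^ k)) + (-landauRe M (L ^ k))))
      (fun y y' => (|a| * (4 * Real.exp ρ * Real.exp ρ / (L : ℝ) ^ k) + rV) * Real.exp (-(ρ * tdistT M y y'))) := by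
  have hsplit : idef (pull (kingPrV L k m M)) (pull (kingPrV L k m M))
        (a • (qvAdjRe M (L ^ m * L ^ k) ∘ₗ qvRe M (L ^ m * L ^ k)) + (-landauRe M (L ^ m * L ^ k))) (a • (qvAdjRe M (L ^ k) ∘ₗ qvRe M (L ^ k)) + (-landauRe M (L ^ k))) =
      a • idef (pull (kingPrV L k m M)) (pull (kingPrV L k m M)) (qvAdjRe M (L ^ m * L ^ k) ∘ₗ qvRe M (L ^ m * L ^ k)) (qvAdjRe M (L ^ k) ∘ₗ qvRe M (L ^ k)) -
        (landauRe M (L ^ m * L ^ k) ∘ₗ pull (kingPrV L k m M) - pull (kingPrV L k m M) ∘ₗ landauRe M (L ^ k)) := by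
    simp only [idef, LinearMap.add_comp, LinearMap.comp_add, LinearMap.smul_comp, LinearMap.comp_smul, LinearMap.neg_comp, LinearMap.comp_neg, smul_sub]
    abel
  have hq := hasMaj_smul_ofBlocks (g := unitTorusGeo L k M) (fun i : Tor (fine (L ^ m * L ^ k) M) × Fin (d + 1) => blockOf (L ^ m * L ^ k) M i.1)
    (fun y y' => by positivity) a (hasMaj_idef_qq M k m hρ)
  rw [hsplit]
  refine (hq.sub hDV).mono fun y y' => le_of_eq ?_
  ring

/-- ★★ **THE OPERATOR LETTER OF THE NONLOCAL PART ON THE TORUS FAMILY, HYPOTHESIS-FREE**: for odd `L ≥ 3`, `a > 0`, `0 < γ < 1` there are `δ, r > 0` such that for EVERY torus exponent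
`m_T`, coarse scale `k ≥ 1` and refinement `m`, with `N_L = a•Q*Q − ∂Π∂*` on both grids of `MP (paramsOf d L m_T k hL)` and King's prolongation `P`:
  `HasMaj (ofBlocks … blkFine) (ofBlocks … blockOf_{L^mL^k}) (𝔇(N′_L, N_L)) (r·(L^k)^{−γ∕2}·e^{−δ|y−y′|_T})`
— the averaging half by §1 (`L^{−k} ≤ (L^k)^{−γ∕2}`), the Landau half = dag-n15-a part 47ff `hasMaj_landauDefect_family` BY NAME.
[cite: Balaban1984PropagatorsI, (1.18) p.20, (1.69)–(1.70) pp.29–30, (1.126) p.38; King1986, Prop. 3.9 (3.73) p.665 (η-rate shape)] -/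
theorem hasMaj_idef_nonlocal_family (hLodd : Odd L) (hL2 : 2 ≤ L) {a : ℝ} (ha : 0 < a) {γ : ℝ} (hγ0 : 0 < γ) (hγ1 : γ < 1) :
    ∃ δ r : ℝ, 0 < δ ∧ 0 < r ∧ ∀ (mT k m : ℕ) (_hk : 1 ≤ k) (hL : Odd L ∧ 1 < L),
      HasMaj (BlockNorm.ofBlocks (unitTorusGeo L k (MP (paramsOf d L mT k hL))) (blkFine L k (MP (paramsOf d L mT k hL))))
        (BlockNorm.ofBlocks (unitTorusGeo L k (MP (paramsOf d L mT k hL)))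
          (fun i : Tor (fine (L ^ m * L ^ k) (MP (paramsOf d L mT k hL))) × Fin (d + 1) => blockOf (L ^ m * L ^ k) (MP (paramsOf d L mT k hL)) i.1))
        (idef (pull (kingPrV L k m (MP (paramsOf d L mT k hL)))) (pull (kingPrV L k m (MP (paramsOf d L mT k hL))))
          (a • (qvAdjRe (MP (paramsOf d L mT k hL)) (L ^ m * L ^ k) ∘ₗ qvRe (MP (paramsOf d L mT k hL)) (L ^ m * L ^ k)) +
            (-landauRe (MP (paramsOf d L mT k hL)) (L ^ m * L ^ k)))
          (a • (qvAdjRe (MP (paramsOf d L mT k hL)) (L ^ k) ∘ₗ qvRe (MP (paramsOf d L mT k hL)) (L ^ k)) + (-landauRe (MP (paramsOf d L mT k hL)) (L ^ k))))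
        (fun y y' => r * ((L ^ k : ℕ) : ℝ) ^ (-(γ / 2)) * Real.exp (-(δ * tdistT (MP (paramsOf d L mT k hL)) y y'))) := by
  obtain ⟨δ, C, hδ, hC, H⟩ := hasMaj_landauDefect_family (d := d) hLodd hL2 ha hγ0 hγ1
  refine ⟨δ, |a| * (4 * Real.exp δ * Real.exp δ) + C, hδ, by positivity, fun mT k m hk hL => ?_⟩
  have hL1 : (1 : ℝ) ≤ L := by exact_mod_cast (show 1 ≤ L by omega)
  have hn1 : (1 : ℝ) ≤ ((L ^ k : ℕ) : ℝ) := by exact_mod_cast Nat.one_le_pow _ _ (by omega)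
  have hρk : 0 ≤ ((L ^ k : ℕ) : ℝ) ^ (-(γ / 2)) := Real.rpow_nonneg (by positivity) _
  have h := hasMaj_idef_nonlocal_of (MP (paramsOf d L mT k hL)) k m (a := a) (rV := C * ((L ^ k : ℕ) : ℝ) ^ (-(γ / 2))) hδ.le
    (H mT k m hk hL)
  refine h.mono fun y y' => mul_le_mul_of_nonneg_right ?_ (Real.exp_nonneg _)
  -- `1∕(L:ℝ)^k ≤ (L^k)^{−γ∕2}`
  have hinv : 1 / (L : ℝ) ^ k ≤ ((L ^ k : ℕ) : ℝ) ^ (-(γ / 2)) := by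
    rw [← Nat.cast_pow, one_div, ← Real.rpow_neg_one]
    exact Real.rpow_le_rpow_of_exponent_le hn1 (by linarith)
  have h4 : 0 ≤ |a| * (4 * Real.exp δ * Real.exp δ) := by positivity
  calc |a| * (4 * Real.exp δ * Real.exp δ / (L : ℝ) ^ k) + C * ((L ^ k : ℕ) : ℝ) ^ (-(γ / 2))
      = |a| * (4 * Real.exp δ * Real.exp δ) * (1 / (L : ℝ) ^ k) + C * ((L ^ k : ℕ) : ℝ) ^ (-(γ / 2)) := by ring
    _ ≤ |a| * (4 * Real.exp δ * Real.exp δ) * ((L ^ k : ℕ) : ℝ) ^ (-(γ / 2)) + C * ((L ^ k : ℕ) : ℝ) ^ (-(γ / 2)) := by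
        gcongr
    _ = (|a| * (4 * Real.exp δ * Real.exp δ) + C) * ((L ^ k : ℕ) : ℝ) ^ (-(γ / 2)) := by ring

end Nonlocal

end Summit.QuantumFields.YangMills.BalabanUVNodes.N15.Gluing

end
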